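/-
Copyright: the b2b-balaban T⁴-continuum CRUX team, row NE7b OWNER lineage `t4-ne7b-p1` (gen 144). Project licence.
-/
import Summits.QuantumFields.BalabanUV.T4Continuum.Spine.NE7b.SupFifthKernelTwoPointLetters
import Summits.QuantumFields.BalabanUV.T4Continuum.Spine.NE7b.SupSupportCountedQuadrupleSums
import Summits.QuantumFields.BalabanUV.T4Continuum.Spine.NE7b.SupFivePointThresholdSlotSums
import Summits.QuantumFields.BalabanUV.T4Continuum.Spine.NE7b.SupFifthKernelSums
import Summits.QuantumFields.BalabanUV.T4Continuum.Spine.NE7b.SupFifthKernelSlotTools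

/-!
# THE FIVE FIXED-SLOT LETTERS OF THE ORDER-FIVE ENTRY MAJORANT, SLOT ONE — THE ROW INDEX (the order-5 block of the kernel-letter CLASS MAP;
# finite sums; the analogue of (528)).  (610)'s background-free majorant `M_{xyzts}` of `|∂⁵W[e_x;e_y,e_z,e_t,e_s]|` is WRITTEN OUT (52
# placements: `K5_{yztsx}`; fifteen two-point letters `E(·,·)`; twenty-five supported stars `𝟙·C3∕(ρρ)`; ten supported sixteen-tree terms
# `𝟙·C4·Σ_TΠr⁻²`; `C5·t⋆⁴`).  FORMAT AUDIT: `K5⁺_{yztsx} := M_{xyzts}` is the output's majorant, so the class needs `M`'s quadruple sums with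
# EACH slot fixed; here the row index `x` (the output's `k5c⁺`):
#   `Σ_{y,z,t,s} M ≤ k5c + (4αr·k5r·αc·hc + hr·αr·αc·k5c + 6αr·k4r·αc·k3c + 4αr·k3r·αc·k4c)·dr·dc∕(1−lamA) + 10n₃C3kS² + 15n²C3hS²`
#   `+ 10n·C4·16S′³ + 576·C5·S₁⁴`
# — every term by a landed finite-sum lemma ((564), (574), (558)) after a reindexing ((595)); NO symmetry of `∂⁵W` or of the majorants is
# used (row NE7b, node U5c; (564), (574), (558), (595) BY NAME; [folklore] finite sums)

Cell `pub-balaban`, sub-cell `t4`, spine estimate NE7b (`T4WeightBudget.RelWeightBound`; the cell's OWN estimate — NOT PRINTED in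
[Bałaban 1983–89], NOT PROVED).  Crux-route work under `Spine/NE7b/` by the row OWNER (`t4-ne7b-p1` gen 144, file (612)) under FREEZE
(0)'s crux-prover clause; NOTHING of Bałaban's is named as a Lean object, valued or asserted; no `T4Continuum/Support` leaf typed; no
`def`, no notation (the majorant WRITTEN OUT as in (610)); zero `sorry`.  Imports (BY NAME): the OWNER's (564), (574), (558), (595), (611) (tools).

WHAT IS PROVED ([folklore]): THE END **`entry_majorant5_slot_x`**; toy.

HONEST (what this is NOT).  Finite sums over (610)'s written-out majorant; the other four slots (`k5r⁺, k5s2⁺, k5s3⁺, k5s4⁺`: the display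
indices fixed, the row index summed — they need the two-point masters at new arities, the `K5`-vector masses with an inner slot fixed and the
support counts of `Hk`∕`K3` in their other index roles), the Schur operator letter and the packaging are the next files.  Scalar skeleton ((A3),
NC-NE7b-α UNRULED); nothing of Bałaban's asserted.  BY-NAME EFFECT ON THE WALL: NONE.  NE7b NOT PRINTED ∕ NOT PROVED; spine PROVED 0∕9; rung
(B)+1 — the programme's measures remain FINITE-torus statements; NOT the mass gap, NOT Clay.  HONEST DEPENDENCY: continuum YM on T⁴ ⇐
BetaPertH ∧ nine spine estimates (0∕9 proved); BetaPertH ⇐ (D1) ∧ (D4) ∧ CAP+tail; G-an2-4 gates asym, D1 and NE2∕3∕4.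
-/

set_option autoImplicit false

noncomputable section

namespace Summit.QuantumFields.BalabanUV.T4Continuum.NE7b.SupFifthKernelEntryLetterSlotOne

open Finset Real Matrix
open scoped BigOperators
open SupFifthKernelTwoPointLetters (two_point5_lone_last_sum_le two_point5_lone_first_sum_le two_point5_third_first_sum_le
  two_point5_hess_first_sum_le)
open SupSupportCountedQuadrupleSums (pair_support_triangle_sum_le nested_pair_support_triangle_sum_le two_supports_triangle_sum_le
  two_supports_triangle_sum_le_two support_tree16_sum_le support_tree16_sum_le_two)
open SupFivePointThresholdSlotSums (threshold_pow4_slot_1)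
open SupFifthKernelSlotTools (sum4_le_abs abs_ite_le abs_ite_ite_le sum4_add const_mul_sum4_le)
open SupFifthKernelSums (sum4_ytsz sum4_zyts sum4_yzst sum4_tyzs sum4_syzt sum4_ztsy sum4_tsyz sum4_ytzs sum4_zsyt sum4_yszt sum4_ztys sum4_sytz
  sum4_zyst sum4_tysz sum4_szty sum4_tzsy)

variable {ι κ : Type} [Fintype ι] [DecidableEq ι] [Fintype κ] [DecidableEq κ]

/-! ## THE END: the row-index slot -/

section TheEnd

variable {Hk : ι → ι → ℝ} {K3 : ι → ι → ι → ℝ} {K4 : ι → ι → ι → ι → ℝ} {K5 : ι → ι → ι → ι → ι → ℝ} {A : Matrix ι κ ℝ} {D : κ → κ → ℝ}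
  {γop κ₂ κ₃ κ₄ lam lamA αr αc hr hc k3r k3c k4r k4c k5r k5c dr dc dθ dθ' αθ βθ S S' S₁ n₃ C3k C3h C4 C5 : ℝ} {ρ r : ι → ι → ℝ} {n : ℕ}

omit [DecidableEq ι] [DecidableEq κ] in
set_option maxHeartbeats 6000000 in
set_option maxRecDepth 4096 in
/-- **THE ROW-INDEX SLOT LETTER OF THE ORDER-FIVE ENTRY MAJORANT** (`k5c⁺`): with the differentiation index `x` fixed, the quadruple sum of
(610)'s written-out majorant `M_{xyzts}` is bounded by the input's letters — 52 finite-sum bounds ((564) two-point letters, (574) support-counted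
star sums, (488)∕(574) sixteen-tree sums, (558) the threshold's root slot), reindexed by (595). [folklore] -/
theorem entry_majorant5_slot_x [Nonempty κ]
    (hK50 : ∀ x y z t u, 0 ≤ K5 x y z t u) (hK40 : ∀ x y z u, 0 ≤ K4 x y z u) (hK30 : ∀ x y u, 0 ≤ K3 x y u) (hHk0 : ∀ v u, 0 ≤ Hk v u)
    (hhr : ∀ v, ∑ u, Hk v u ≤ hr) (hhc : ∀ u, ∑ v, Hk v u ≤ hc) (hk3r : ∀ x, ∑ y, ∑ u, K3 x y u ≤ k3r) (hk3c : ∀ u, ∑ y, ∑ z, K3 y z u ≤ k3c)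
    (hk4r : ∀ x, ∑ y, ∑ z, ∑ u, K4 x y z u ≤ k4r) (hk4c : ∀ u, ∑ y, ∑ z, ∑ t, K4 y z t u ≤ k4c)
    (hk5r : ∀ x, ∑ y, ∑ z, ∑ t, ∑ u, K5 x y z t u ≤ k5r) (hk5c : ∀ u, ∑ y, ∑ z, ∑ t, ∑ s, K5 y z t s u ≤ k5c)
    (hαr : ∀ u, ∑ w, |A u w| ≤ αr) (hαc : ∀ w, ∑ u, |A u w| ≤ αc) (hlamA1 : lamA < 1)
    (hD : ∀ x y, 0 ≤ D x y) (hDr : ∀ z, ∑ w, D z w ≤ dr) (hDc : ∀ w, ∑ z, D z w ≤ dc)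
    (hρ1 : ∀ x y, 1 ≤ ρ x y) (hr1 : ∀ x y, 1 ≤ r x y) (hrs : ∀ u v, r u v = r v u)
    (hSr : ∀ u, ∑ v, (r u v ^ 2)⁻¹ ≤ S') (hSc : ∀ v, ∑ u, (r u v ^ 2)⁻¹ ≤ S') (hS1 : ∀ u, ∑ v, (r u v)⁻¹ ≤ S₁)
    (hn : ∀ y : ι, (Finset.univ.filter (fun z => Hk z y ≠ 0)).card ≤ n)
    (hn3 : ∀ y : ι, ∑ z, ((Finset.univ.filter (fun t => K3 z t y ≠ 0)).card : ℝ) ≤ n₃)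
    (hC3k0 : 0 ≤ C3k) (hC3h0 : 0 ≤ C3h) (hC40 : 0 ≤ C4) (hC50 : 0 ≤ C5) (x : ι) (hS : ∑ v, 1 / ρ x v ≤ S) :
    ∑ y, ∑ z, ∑ t, ∑ s, (((K5 y z t s x : ℝ) + (∑ w, (∑ z', D z' w * ∑ u, |A u z'| * Hk x u) * (∑ z', D z' w * ∑ u, |A u z'| * K5 y z t s u) / (1 -
        lamA) : ℝ)) +
        ((∑ w, (∑ z', D z' w * ∑ u, |A u z'| * K5 x y t s u) * (∑ z', D z' w * ∑ u, |A u z'| * Hk z u) / (1 - lamA) : ℝ) + (∑ w, (∑ z', D z' w * ∑ u,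
            |A u z'| * K3 x z u) * (∑ z', D z' w * ∑ u, |A u z'| * K4 y t s u) / (1 - lamA) : ℝ) + (if K3 t s y = 0 then 0 else C3k / (ρ x y * ρ x z)
            : ℝ) + (∑ w, (∑ z', D z' w * ∑ u, |A u z'| * K5 x y z s u) * (∑ z', D z' w * ∑ u, |A u z'| * Hk t u) / (1 - lamA) : ℝ) + (∑ w, (∑ z', D
            z' w * ∑ u, |A u z'| * K3 x t u) * (∑ z', D z' w * ∑ u, |A u z'| * K4 y z s u) / (1 - lamA) : ℝ) + (if K3 z s y = 0 then 0 else C3k / (ρ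
            x y * ρ x t) : ℝ) + (∑ w, (∑ z', D z' w * ∑ u, |A u z'| * K5 x y z t u) * (∑ z', D z' w * ∑ u, |A u z'| * Hk s u) / (1 - lamA) : ℝ) + (∑
            w, (∑ z', D z' w * ∑ u, |A u z'| * K3 x s u) * (∑ z', D z' w * ∑ u, |A u z'| * K4 y z t u) / (1 - lamA) : ℝ) + (if K3 z t y = 0 then 0
            else C3k / (ρ x y * ρ x s) : ℝ) + (∑ w, (∑ z', D z' w * ∑ u, |A u z'| * K3 x y u) * (∑ z', D z' w * ∑ u, |A u z'| * K4 z t s u) / (1 -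
            lamA) : ℝ) + (∑ w, (∑ z', D z' w * ∑ u, |A u z'| * K5 x z t s u) * (∑ z', D z' w * ∑ u, |A u z'| * Hk y u) / (1 - lamA) : ℝ) + (if K3 t s
            z = 0 then 0 else C3k / (ρ x z * ρ x y) : ℝ)) +
        ((∑ w, (∑ z', D z' w * ∑ u, |A u z'| * K4 x y z u) * (∑ z', D z' w * ∑ u, |A u z'| * K3 t s u) / (1 - lamA) : ℝ) + (∑ w, (∑ z', D z' w * ∑ u,
            |A u z'| * K4 x t s u) * (∑ z', D z' w * ∑ u, |A u z'| * K3 y z u) / (1 - lamA) : ℝ) + (if Hk z y = 0 then 0 else if Hk s t = 0 then 0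
            else C3h / (ρ x y * ρ x t) : ℝ) + (∑ w, (∑ z', D z' w * ∑ u, |A u z'| * K4 x y t u) * (∑ z', D z' w * ∑ u, |A u z'| * K3 z s u) / (1 -
            lamA) : ℝ) + (∑ w, (∑ z', D z' w * ∑ u, |A u z'| * K4 x z s u) * (∑ z', D z' w * ∑ u, |A u z'| * K3 y t u) / (1 - lamA) : ℝ) + (if Hk t y
            = 0 then 0 else if Hk s z = 0 then 0 else C3h / (ρ x y * ρ x z) : ℝ) + (∑ w, (∑ z', D z' w * ∑ u, |A u z'| * K4 x y s u) * (∑ z', D z' w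
            * ∑ u, |A u z'| * K3 z t u) / (1 - lamA) : ℝ) + (∑ w, (∑ z', D z' w * ∑ u, |A u z'| * K4 x z t u) * (∑ z', D z' w * ∑ u, |A u z'| * K3 y
            s u) / (1 - lamA) : ℝ) + (if Hk s y = 0 then 0 else if Hk t z = 0 then 0 else C3h / (ρ x y * ρ x z) : ℝ)) +
        ((if K3 y z x = 0 then 0 else C3k / (ρ x t * ρ x s) : ℝ) + (if Hk t x = 0 then 0 else if Hk z y = 0 then 0 else C3h / (ρ x y * ρ x s) : ℝ) +
            (if Hk s x = 0 then 0 else if Hk z y = 0 then 0 else C3h / (ρ x y * ρ x t) : ℝ) + (if Hk z y = 0 then 0 else C4 * (((r x y ^ 2)⁻¹ * (r x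
            t ^ 2)⁻¹ * (r x s ^ 2)⁻¹ + (r x y ^ 2)⁻¹ * (r y t ^ 2)⁻¹ * (r y s ^ 2)⁻¹ + (r x t ^ 2)⁻¹ * (r y t ^ 2)⁻¹ * (r t s ^ 2)⁻¹ + (r x s ^ 2)⁻¹
            * (r y s ^ 2)⁻¹ * (r t s ^ 2)⁻¹ + (r x y ^ 2)⁻¹ * (r y t ^ 2)⁻¹ * (r t s ^ 2)⁻¹ + (r x y ^ 2)⁻¹ * (r y s ^ 2)⁻¹ * (r t s ^ 2)⁻¹ + (r x t
            ^ 2)⁻¹ * (r y t ^ 2)⁻¹ * (r y s ^ 2)⁻¹ + (r x t ^ 2)⁻¹ * (r y s ^ 2)⁻¹ * (r t s ^ 2)⁻¹ + (r x s ^ 2)⁻¹ * (r y t ^ 2)⁻¹ * (r y s ^ 2)⁻¹ +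
            (r x s ^ 2)⁻¹ * (r y t ^ 2)⁻¹ * (r t s ^ 2)⁻¹ + (r x y ^ 2)⁻¹ * (r x t ^ 2)⁻¹ * (r t s ^ 2)⁻¹ + (r x y ^ 2)⁻¹ * (r x s ^ 2)⁻¹ * (r t s ^
            2)⁻¹ + (r x y ^ 2)⁻¹ * (r x t ^ 2)⁻¹ * (r y s ^ 2)⁻¹ + (r x t ^ 2)⁻¹ * (r x s ^ 2)⁻¹ * (r y s ^ 2)⁻¹ + (r x y ^ 2)⁻¹ * (r x s ^ 2)⁻¹ * (r
            y t ^ 2)⁻¹ + (r x t ^ 2)⁻¹ * (r x s ^ 2)⁻¹ * (r y t ^ 2)⁻¹)) : ℝ) + (if K3 y t x = 0 then 0 else C3k / (ρ x z * ρ x s) : ℝ) + (if Hk z x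
            = 0 then 0 else if Hk t y = 0 then 0 else C3h / (ρ x y * ρ x s) : ℝ) + (if Hk s x = 0 then 0 else if Hk t y = 0 then 0 else C3h / (ρ x y
            * ρ x z) : ℝ) + (if Hk t y = 0 then 0 else C4 * (((r x y ^ 2)⁻¹ * (r x z ^ 2)⁻¹ * (r x s ^ 2)⁻¹ + (r x y ^ 2)⁻¹ * (r y z ^ 2)⁻¹ * (r y s
            ^ 2)⁻¹ + (r x z ^ 2)⁻¹ * (r y z ^ 2)⁻¹ * (r z s ^ 2)⁻¹ + (r x s ^ 2)⁻¹ * (r y s ^ 2)⁻¹ * (r z s ^ 2)⁻¹ + (r x y ^ 2)⁻¹ * (r y z ^ 2)⁻¹ *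
            (r z s ^ 2)⁻¹ + (r x y ^ 2)⁻¹ * (r y s ^ 2)⁻¹ * (r z s ^ 2)⁻¹ + (r x z ^ 2)⁻¹ * (r y z ^ 2)⁻¹ * (r y s ^ 2)⁻¹ + (r x z ^ 2)⁻¹ * (r y s ^
            2)⁻¹ * (r z s ^ 2)⁻¹ + (r x s ^ 2)⁻¹ * (r y z ^ 2)⁻¹ * (r y s ^ 2)⁻¹ + (r x s ^ 2)⁻¹ * (r y z ^ 2)⁻¹ * (r z s ^ 2)⁻¹ + (r x y ^ 2)⁻¹ * (r
            x z ^ 2)⁻¹ * (r z s ^ 2)⁻¹ + (r x y ^ 2)⁻¹ * (r x s ^ 2)⁻¹ * (r z s ^ 2)⁻¹ + (r x y ^ 2)⁻¹ * (r x z ^ 2)⁻¹ * (r y s ^ 2)⁻¹ + (r x z ^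
            2)⁻¹ * (r x s ^ 2)⁻¹ * (r y s ^ 2)⁻¹ + (r x y ^ 2)⁻¹ * (r x s ^ 2)⁻¹ * (r y z ^ 2)⁻¹ + (r x z ^ 2)⁻¹ * (r x s ^ 2)⁻¹ * (r y z ^ 2)⁻¹)) :
            ℝ) + (if K3 y s x = 0 then 0 else C3k / (ρ x z * ρ x t) : ℝ) + (if Hk z x = 0 then 0 else if Hk s y = 0 then 0 else C3h / (ρ x y * ρ x t)
            : ℝ) + (if Hk t x = 0 then 0 else if Hk s y = 0 then 0 else C3h / (ρ x y * ρ x z) : ℝ) + (if Hk s y = 0 then 0 else C4 * (((r x y ^ 2)⁻¹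
            * (r x z ^ 2)⁻¹ * (r x t ^ 2)⁻¹ + (r x y ^ 2)⁻¹ * (r y z ^ 2)⁻¹ * (r y t ^ 2)⁻¹ + (r x z ^ 2)⁻¹ * (r y z ^ 2)⁻¹ * (r z t ^ 2)⁻¹ + (r x t
            ^ 2)⁻¹ * (r y t ^ 2)⁻¹ * (r z t ^ 2)⁻¹ + (r x y ^ 2)⁻¹ * (r y z ^ 2)⁻¹ * (r z t ^ 2)⁻¹ + (r x y ^ 2)⁻¹ * (r y t ^ 2)⁻¹ * (r z t ^ 2)⁻¹ +
            (r x z ^ 2)⁻¹ * (r y z ^ 2)⁻¹ * (r y t ^ 2)⁻¹ + (r x z ^ 2)⁻¹ * (r y t ^ 2)⁻¹ * (r z t ^ 2)⁻¹ + (r x t ^ 2)⁻¹ * (r y z ^ 2)⁻¹ * (r y t ^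
            2)⁻¹ + (r x t ^ 2)⁻¹ * (r y z ^ 2)⁻¹ * (r z t ^ 2)⁻¹ + (r x y ^ 2)⁻¹ * (r x z ^ 2)⁻¹ * (r z t ^ 2)⁻¹ + (r x y ^ 2)⁻¹ * (r x t ^ 2)⁻¹ * (r
            z t ^ 2)⁻¹ + (r x y ^ 2)⁻¹ * (r x z ^ 2)⁻¹ * (r y t ^ 2)⁻¹ + (r x z ^ 2)⁻¹ * (r x t ^ 2)⁻¹ * (r y t ^ 2)⁻¹ + (r x y ^ 2)⁻¹ * (r x t ^
            2)⁻¹ * (r y z ^ 2)⁻¹ + (r x z ^ 2)⁻¹ * (r x t ^ 2)⁻¹ * (r y z ^ 2)⁻¹)) : ℝ)) +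
        ((if Hk y x = 0 then 0 else if Hk t z = 0 then 0 else C3h / (ρ x z * ρ x s) : ℝ) + (if K3 z t x = 0 then 0 else C3k / (ρ x y * ρ x s) : ℝ) +
            (if Hk s x = 0 then 0 else if Hk t z = 0 then 0 else C3h / (ρ x z * ρ x y) : ℝ) + (if Hk t z = 0 then 0 else C4 * (((r x z ^ 2)⁻¹ * (r x
            y ^ 2)⁻¹ * (r x s ^ 2)⁻¹ + (r x z ^ 2)⁻¹ * (r z y ^ 2)⁻¹ * (r z s ^ 2)⁻¹ + (r x y ^ 2)⁻¹ * (r z y ^ 2)⁻¹ * (r y s ^ 2)⁻¹ + (r x s ^ 2)⁻¹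
            * (r z s ^ 2)⁻¹ * (r y s ^ 2)⁻¹ + (r x z ^ 2)⁻¹ * (r z y ^ 2)⁻¹ * (r y s ^ 2)⁻¹ + (r x z ^ 2)⁻¹ * (r z s ^ 2)⁻¹ * (r y s ^ 2)⁻¹ + (r x y
            ^ 2)⁻¹ * (r z y ^ 2)⁻¹ * (r z s ^ 2)⁻¹ + (r x y ^ 2)⁻¹ * (r z s ^ 2)⁻¹ * (r y s ^ 2)⁻¹ + (r x s ^ 2)⁻¹ * (r z y ^ 2)⁻¹ * (r z s ^ 2)⁻¹ +
            (r x s ^ 2)⁻¹ * (r z y ^ 2)⁻¹ * (r y s ^ 2)⁻¹ + (r x z ^ 2)⁻¹ * (r x y ^ 2)⁻¹ * (r y s ^ 2)⁻¹ + (r x z ^ 2)⁻¹ * (r x s ^ 2)⁻¹ * (r y s ^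
            2)⁻¹ + (r x z ^ 2)⁻¹ * (r x y ^ 2)⁻¹ * (r z s ^ 2)⁻¹ + (r x y ^ 2)⁻¹ * (r x s ^ 2)⁻¹ * (r z s ^ 2)⁻¹ + (r x z ^ 2)⁻¹ * (r x s ^ 2)⁻¹ * (r
            z y ^ 2)⁻¹ + (r x y ^ 2)⁻¹ * (r x s ^ 2)⁻¹ * (r z y ^ 2)⁻¹)) : ℝ) + (if Hk y x = 0 then 0 else if Hk s z = 0 then 0 else C3h / (ρ x z * ρ
            x t) : ℝ) + (if K3 z s x = 0 then 0 else C3k / (ρ x y * ρ x t) : ℝ) + (if Hk t x = 0 then 0 else if Hk s z = 0 then 0 else C3h / (ρ x z *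
            ρ x y) : ℝ) + (if Hk s z = 0 then 0 else C4 * (((r x z ^ 2)⁻¹ * (r x y ^ 2)⁻¹ * (r x t ^ 2)⁻¹ + (r x z ^ 2)⁻¹ * (r z y ^ 2)⁻¹ * (r z t ^
            2)⁻¹ + (r x y ^ 2)⁻¹ * (r z y ^ 2)⁻¹ * (r y t ^ 2)⁻¹ + (r x t ^ 2)⁻¹ * (r z t ^ 2)⁻¹ * (r y t ^ 2)⁻¹ + (r x z ^ 2)⁻¹ * (r z y ^ 2)⁻¹ * (r
            y t ^ 2)⁻¹ + (r x z ^ 2)⁻¹ * (r z t ^ 2)⁻¹ * (r y t ^ 2)⁻¹ + (r x y ^ 2)⁻¹ * (r z y ^ 2)⁻¹ * (r z t ^ 2)⁻¹ + (r x y ^ 2)⁻¹ * (r z t ^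
            2)⁻¹ * (r y t ^ 2)⁻¹ + (r x t ^ 2)⁻¹ * (r z y ^ 2)⁻¹ * (r z t ^ 2)⁻¹ + (r x t ^ 2)⁻¹ * (r z y ^ 2)⁻¹ * (r y t ^ 2)⁻¹ + (r x z ^ 2)⁻¹ * (r
            x y ^ 2)⁻¹ * (r y t ^ 2)⁻¹ + (r x z ^ 2)⁻¹ * (r x t ^ 2)⁻¹ * (r y t ^ 2)⁻¹ + (r x z ^ 2)⁻¹ * (r x y ^ 2)⁻¹ * (r z t ^ 2)⁻¹ + (r x y ^
            2)⁻¹ * (r x t ^ 2)⁻¹ * (r z t ^ 2)⁻¹ + (r x z ^ 2)⁻¹ * (r x t ^ 2)⁻¹ * (r z y ^ 2)⁻¹ + (r x y ^ 2)⁻¹ * (r x t ^ 2)⁻¹ * (r z y ^ 2)⁻¹)) :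
            ℝ) + (if Hk y x = 0 then 0 else if Hk s t = 0 then 0 else C3h / (ρ x t * ρ x z) : ℝ) + (if K3 t s x = 0 then 0 else C3k / (ρ x y * ρ x z)
            : ℝ) + (if Hk z x = 0 then 0 else if Hk s t = 0 then 0 else C3h / (ρ x t * ρ x y) : ℝ) + (if Hk s t = 0 then 0 else C4 * (((r x t ^ 2)⁻¹
            * (r x y ^ 2)⁻¹ * (r x z ^ 2)⁻¹ + (r x t ^ 2)⁻¹ * (r t y ^ 2)⁻¹ * (r t z ^ 2)⁻¹ + (r x y ^ 2)⁻¹ * (r t y ^ 2)⁻¹ * (r y z ^ 2)⁻¹ + (r x z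
            ^ 2)⁻¹ * (r t z ^ 2)⁻¹ * (r y z ^ 2)⁻¹ + (r x t ^ 2)⁻¹ * (r t y ^ 2)⁻¹ * (r y z ^ 2)⁻¹ + (r x t ^ 2)⁻¹ * (r t z ^ 2)⁻¹ * (r y z ^ 2)⁻¹ +
            (r x y ^ 2)⁻¹ * (r t y ^ 2)⁻¹ * (r t z ^ 2)⁻¹ + (r x y ^ 2)⁻¹ * (r t z ^ 2)⁻¹ * (r y z ^ 2)⁻¹ + (r x z ^ 2)⁻¹ * (r t y ^ 2)⁻¹ * (r t z ^
            2)⁻¹ + (r x z ^ 2)⁻¹ * (r t y ^ 2)⁻¹ * (r y z ^ 2)⁻¹ + (r x t ^ 2)⁻¹ * (r x y ^ 2)⁻¹ * (r y z ^ 2)⁻¹ + (r x t ^ 2)⁻¹ * (r x z ^ 2)⁻¹ * (r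
            y z ^ 2)⁻¹ + (r x t ^ 2)⁻¹ * (r x y ^ 2)⁻¹ * (r t z ^ 2)⁻¹ + (r x y ^ 2)⁻¹ * (r x z ^ 2)⁻¹ * (r t z ^ 2)⁻¹ + (r x t ^ 2)⁻¹ * (r x z ^
            2)⁻¹ * (r t y ^ 2)⁻¹ + (r x y ^ 2)⁻¹ * (r x z ^ 2)⁻¹ * (r t y ^ 2)⁻¹)) : ℝ)) +
        ((if Hk y x = 0 then 0 else C4 * (((r x z ^ 2)⁻¹ * (r x t ^ 2)⁻¹ * (r x s ^ 2)⁻¹ + (r x z ^ 2)⁻¹ * (r z t ^ 2)⁻¹ * (r z s ^ 2)⁻¹ + (r x t ^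
            2)⁻¹ * (r z t ^ 2)⁻¹ * (r t s ^ 2)⁻¹ + (r x s ^ 2)⁻¹ * (r z s ^ 2)⁻¹ * (r t s ^ 2)⁻¹ + (r x z ^ 2)⁻¹ * (r z t ^ 2)⁻¹ * (r t s ^ 2)⁻¹ + (r
            x z ^ 2)⁻¹ * (r z s ^ 2)⁻¹ * (r t s ^ 2)⁻¹ + (r x t ^ 2)⁻¹ * (r z t ^ 2)⁻¹ * (r z s ^ 2)⁻¹ + (r x t ^ 2)⁻¹ * (r z s ^ 2)⁻¹ * (r t s ^
            2)⁻¹ + (r x s ^ 2)⁻¹ * (r z t ^ 2)⁻¹ * (r z s ^ 2)⁻¹ + (r x s ^ 2)⁻¹ * (r z t ^ 2)⁻¹ * (r t s ^ 2)⁻¹ + (r x z ^ 2)⁻¹ * (r x t ^ 2)⁻¹ * (r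
            t s ^ 2)⁻¹ + (r x z ^ 2)⁻¹ * (r x s ^ 2)⁻¹ * (r t s ^ 2)⁻¹ + (r x z ^ 2)⁻¹ * (r x t ^ 2)⁻¹ * (r z s ^ 2)⁻¹ + (r x t ^ 2)⁻¹ * (r x s ^
            2)⁻¹ * (r z s ^ 2)⁻¹ + (r x z ^ 2)⁻¹ * (r x s ^ 2)⁻¹ * (r z t ^ 2)⁻¹ + (r x t ^ 2)⁻¹ * (r x s ^ 2)⁻¹ * (r z t ^ 2)⁻¹)) : ℝ) + (if Hk z x
            = 0 then 0 else C4 * (((r x y ^ 2)⁻¹ * (r x t ^ 2)⁻¹ * (r x s ^ 2)⁻¹ + (r x y ^ 2)⁻¹ * (r y t ^ 2)⁻¹ * (r y s ^ 2)⁻¹ + (r x t ^ 2)⁻¹ * (r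
            y t ^ 2)⁻¹ * (r t s ^ 2)⁻¹ + (r x s ^ 2)⁻¹ * (r y s ^ 2)⁻¹ * (r t s ^ 2)⁻¹ + (r x y ^ 2)⁻¹ * (r y t ^ 2)⁻¹ * (r t s ^ 2)⁻¹ + (r x y ^
            2)⁻¹ * (r y s ^ 2)⁻¹ * (r t s ^ 2)⁻¹ + (r x t ^ 2)⁻¹ * (r y t ^ 2)⁻¹ * (r y s ^ 2)⁻¹ + (r x t ^ 2)⁻¹ * (r y s ^ 2)⁻¹ * (r t s ^ 2)⁻¹ + (r
            x s ^ 2)⁻¹ * (r y t ^ 2)⁻¹ * (r y s ^ 2)⁻¹ + (r x s ^ 2)⁻¹ * (r y t ^ 2)⁻¹ * (r t s ^ 2)⁻¹ + (r x y ^ 2)⁻¹ * (r x t ^ 2)⁻¹ * (r t s ^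
            2)⁻¹ + (r x y ^ 2)⁻¹ * (r x s ^ 2)⁻¹ * (r t s ^ 2)⁻¹ + (r x y ^ 2)⁻¹ * (r x t ^ 2)⁻¹ * (r y s ^ 2)⁻¹ + (r x t ^ 2)⁻¹ * (r x s ^ 2)⁻¹ * (r
            y s ^ 2)⁻¹ + (r x y ^ 2)⁻¹ * (r x s ^ 2)⁻¹ * (r y t ^ 2)⁻¹ + (r x t ^ 2)⁻¹ * (r x s ^ 2)⁻¹ * (r y t ^ 2)⁻¹)) : ℝ) + (if Hk t x = 0 then 0
            else C4 * (((r x y ^ 2)⁻¹ * (r x z ^ 2)⁻¹ * (r x s ^ 2)⁻¹ + (r x y ^ 2)⁻¹ * (r y z ^ 2)⁻¹ * (r y s ^ 2)⁻¹ + (r x z ^ 2)⁻¹ * (r y z ^ 2)⁻¹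
            * (r z s ^ 2)⁻¹ + (r x s ^ 2)⁻¹ * (r y s ^ 2)⁻¹ * (r z s ^ 2)⁻¹ + (r x y ^ 2)⁻¹ * (r y z ^ 2)⁻¹ * (r z s ^ 2)⁻¹ + (r x y ^ 2)⁻¹ * (r y s
            ^ 2)⁻¹ * (r z s ^ 2)⁻¹ + (r x z ^ 2)⁻¹ * (r y z ^ 2)⁻¹ * (r y s ^ 2)⁻¹ + (r x z ^ 2)⁻¹ * (r y s ^ 2)⁻¹ * (r z s ^ 2)⁻¹ + (r x s ^ 2)⁻¹ *
            (r y z ^ 2)⁻¹ * (r y s ^ 2)⁻¹ + (r x s ^ 2)⁻¹ * (r y z ^ 2)⁻¹ * (r z s ^ 2)⁻¹ + (r x y ^ 2)⁻¹ * (r x z ^ 2)⁻¹ * (r z s ^ 2)⁻¹ + (r x y ^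
            2)⁻¹ * (r x s ^ 2)⁻¹ * (r z s ^ 2)⁻¹ + (r x y ^ 2)⁻¹ * (r x z ^ 2)⁻¹ * (r y s ^ 2)⁻¹ + (r x z ^ 2)⁻¹ * (r x s ^ 2)⁻¹ * (r y s ^ 2)⁻¹ + (r
            x y ^ 2)⁻¹ * (r x s ^ 2)⁻¹ * (r y z ^ 2)⁻¹ + (r x z ^ 2)⁻¹ * (r x s ^ 2)⁻¹ * (r y z ^ 2)⁻¹)) : ℝ) + (if Hk s x = 0 then 0 else C4 * (((r
            x y ^ 2)⁻¹ * (r x z ^ 2)⁻¹ * (r x t ^ 2)⁻¹ + (r x y ^ 2)⁻¹ * (r y z ^ 2)⁻¹ * (r y t ^ 2)⁻¹ + (r x z ^ 2)⁻¹ * (r y z ^ 2)⁻¹ * (r z t ^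
            2)⁻¹ + (r x t ^ 2)⁻¹ * (r y t ^ 2)⁻¹ * (r z t ^ 2)⁻¹ + (r x y ^ 2)⁻¹ * (r y z ^ 2)⁻¹ * (r z t ^ 2)⁻¹ + (r x y ^ 2)⁻¹ * (r y t ^ 2)⁻¹ * (r
            z t ^ 2)⁻¹ + (r x z ^ 2)⁻¹ * (r y z ^ 2)⁻¹ * (r y t ^ 2)⁻¹ + (r x z ^ 2)⁻¹ * (r y t ^ 2)⁻¹ * (r z t ^ 2)⁻¹ + (r x t ^ 2)⁻¹ * (r y z ^
            2)⁻¹ * (r y t ^ 2)⁻¹ + (r x t ^ 2)⁻¹ * (r y z ^ 2)⁻¹ * (r z t ^ 2)⁻¹ + (r x y ^ 2)⁻¹ * (r x z ^ 2)⁻¹ * (r z t ^ 2)⁻¹ + (r x y ^ 2)⁻¹ * (r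
            x t ^ 2)⁻¹ * (r z t ^ 2)⁻¹ + (r x y ^ 2)⁻¹ * (r x z ^ 2)⁻¹ * (r y t ^ 2)⁻¹ + (r x z ^ 2)⁻¹ * (r x t ^ 2)⁻¹ * (r y t ^ 2)⁻¹ + (r x y ^
            2)⁻¹ * (r x t ^ 2)⁻¹ * (r y z ^ 2)⁻¹ + (r x z ^ 2)⁻¹ * (r x t ^ 2)⁻¹ * (r y z ^ 2)⁻¹)) : ℝ) + (C5 * (min (max (r x y)⁻¹ (max (r x z)⁻¹
            (max (r x t)⁻¹ (r x s)⁻¹))) (min (max (r x z)⁻¹ (max (r y z)⁻¹ (max (r x t)⁻¹ (max (r y t)⁻¹ (max (r x s)⁻¹ (r y s)⁻¹))))) (min (max (r x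
            y)⁻¹ (max (r y z)⁻¹ (max (r x t)⁻¹ (max (r z t)⁻¹ (max (r x s)⁻¹ (r z s)⁻¹))))) (min (max (r x y)⁻¹ (max (r y t)⁻¹ (max (r x z)⁻¹ (max (r
            z t)⁻¹ (max (r x s)⁻¹ (r t s)⁻¹))))) (min (max (r x y)⁻¹ (max (r y s)⁻¹ (max (r x z)⁻¹ (max (r z s)⁻¹ (max (r x t)⁻¹ (r t s)⁻¹))))) (min
            (max (r x t)⁻¹ (max (r y t)⁻¹ (max (r z t)⁻¹ (max (r x s)⁻¹ (max (r y s)⁻¹ (r z s)⁻¹))))) (min (max (r x z)⁻¹ (max (r y z)⁻¹ (max (r z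
            t)⁻¹ (max (r x s)⁻¹ (max (r y s)⁻¹ (r t s)⁻¹))))) (min (max (r x z)⁻¹ (max (r y z)⁻¹ (max (r z s)⁻¹ (max (r x t)⁻¹ (max (r y t)⁻¹ (r t
            s)⁻¹))))) (min (max (r x y)⁻¹ (max (r y z)⁻¹ (max (r y t)⁻¹ (max (r x s)⁻¹ (max (r z s)⁻¹ (r t s)⁻¹))))) (min (max (r x y)⁻¹ (max (r y
            z)⁻¹ (max (r y s)⁻¹ (max (r x t)⁻¹ (max (r z t)⁻¹ (r t s)⁻¹))))) (min (max (r x y)⁻¹ (max (r y t)⁻¹ (max (r y s)⁻¹ (max (r x z)⁻¹ (max (r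
            z t)⁻¹ (r z s)⁻¹))))) (min (max (r x s)⁻¹ (max (r y s)⁻¹ (max (r z s)⁻¹ (r t s)⁻¹))) (min (max (r x t)⁻¹ (max (r y t)⁻¹ (max (r z t)⁻¹ (r
            t s)⁻¹))) (min (max (r x z)⁻¹ (max (r y z)⁻¹ (max (r z t)⁻¹ (r z s)⁻¹))) (max (r x y)⁻¹ (max (r y z)⁻¹ (max (r y t)⁻¹ (r y
            s)⁻¹))))))))))))))))) ^ 4 : ℝ))) ≤
      k5c + (4 * (αr * k5r * (αc * hc)) + hr * αr * (αc * k5c) + 6 * (αr * k4r * (αc * k3c)) + 4 * (αr * k3r * (αc * k4c))) * dr * dc / (1 - lamA) +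
        10 * (n₃ * (C3k * S ^ 2)) + 15 * ((n : ℝ) * n * (C3h * S ^ 2)) + 10 * ((n : ℝ) * (C4 * (16 * S' ^ 3))) + C5 * (576 * S₁ ^ 4) := by
  haveI : Nonempty ι := ⟨x⟩
  have hl1 : 0 < 1 - lamA := by linarith
  have hρ0 : ∀ a b, 0 < ρ a b := fun a b => zero_lt_one.trans_le (hρ1 a b)
  have hS10 : 0 ≤ S₁ := (Finset.sum_nonneg fun v _ => inv_nonneg.2 (zero_le_one.trans (hr1 x v))).trans (hS1 x)
  have hnR : ∀ y : ι, ((Finset.univ.filter (fun z => Hk z y ≠ 0)).card : ℝ) ≤ (n : ℝ) := fun y => by exact_mod_cast hn y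
  have h1 := hk5c x
  have h2 := (two_point5_lone_first_sum_le hK50 hHk0 hαr hαc hhr hk5c hD hDr hDc hl1 x)
  have h3 := ((sum4_ytsz _).trans_le (two_point5_lone_last_sum_le hK50 hHk0 hαr hαc hhc hk5r hD hDr hDc hl1 x))
  have h4 := ((sum4_zyts _).trans_le (two_point5_hess_first_sum_le hK40 hK30 hαr hαc hk3r hk4c hD hDr hDc hl1 x))
  have h5 := ((sum4_ytsz _).trans_le ((sum4_le_abs _).trans (nested_pair_support_triangle_sum_le (fun a b c d : ι => if K3 b c a = 0 then (0:ℝ) else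
      C3k / (ρ x a * ρ x d)) (fun a b c => K3 b c a) x hC3k0 hρ1 hS (fun a b c h d => if_pos h) (fun a b c d => abs_ite_le (div_nonneg hC3k0 (mul_pos
      (hρ0 x a) (hρ0 x d)).le)) hn3)))
  have h6 := ((sum4_yzst _).trans_le (two_point5_lone_last_sum_le hK50 hHk0 hαr hαc hhc hk5r hD hDr hDc hl1 x))
  have h7 := ((sum4_tyzs _).trans_le (two_point5_hess_first_sum_le hK40 hK30 hαr hαc hk3r hk4c hD hDr hDc hl1 x))
  have h8 := ((sum4_yzst _).trans_le ((sum4_le_abs _).trans (nested_pair_support_triangle_sum_le (fun a b c d : ι => if K3 b c a = 0 then (0:ℝ) else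
      C3k / (ρ x a * ρ x d)) (fun a b c => K3 b c a) x hC3k0 hρ1 hS (fun a b c h d => if_pos h) (fun a b c d => abs_ite_le (div_nonneg hC3k0 (mul_pos
      (hρ0 x a) (hρ0 x d)).le)) hn3)))
  have h9 := (two_point5_lone_last_sum_le hK50 hHk0 hαr hαc hhc hk5r hD hDr hDc hl1 x)
  have h10 := ((sum4_syzt _).trans_le (two_point5_hess_first_sum_le hK40 hK30 hαr hαc hk3r hk4c hD hDr hDc hl1 x))
  have h11 := ((sum4_le_abs _).trans (nested_pair_support_triangle_sum_le (fun a b c d : ι => if K3 b c a = 0 then (0:ℝ) else C3k / (ρ x a * ρ x d))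
      (fun a b c => K3 b c a) x hC3k0 hρ1 hS (fun a b c h d => if_pos h) (fun a b c d => abs_ite_le (div_nonneg hC3k0 (mul_pos (hρ0 x a) (hρ0 x
      d)).le)) hn3))
  have h12 := (two_point5_hess_first_sum_le hK40 hK30 hαr hαc hk3r hk4c hD hDr hDc hl1 x)
  have h13 := ((sum4_ztsy _).trans_le (two_point5_lone_last_sum_le hK50 hHk0 hαr hαc hhc hk5r hD hDr hDc hl1 x))
  have h14 := ((sum4_ztsy _).trans_le ((sum4_le_abs _).trans (nested_pair_support_triangle_sum_le (fun a b c d : ι => if K3 b c a = 0 then (0:ℝ) else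
      C3k / (ρ x a * ρ x d)) (fun a b c => K3 b c a) x hC3k0 hρ1 hS (fun a b c h d => if_pos h) (fun a b c d => abs_ite_le (div_nonneg hC3k0 (mul_pos
      (hρ0 x a) (hρ0 x d)).le)) hn3)))
  have h15 := (two_point5_third_first_sum_le hK40 hK30 hαr hαc hk4r hk3c hD hDr hDc hl1 x)
  have h16 := ((sum4_tsyz _).trans_le (two_point5_third_first_sum_le hK40 hK30 hαr hαc hk4r hk3c hD hDr hDc hl1 x))
  have h17 := ((sum4_le_abs _).trans (two_supports_triangle_sum_le_two (fun a b c d : ι => if Hk b a = 0 then (0:ℝ) else if Hk d c = 0 then (0:ℝ)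
      else C3h / (ρ x a * ρ x c)) (fun a b => Hk b a) (fun c d => Hk d c) x hC3h0 hρ1 hS (fun a b h c d => if_pos h) (fun c d h a b => by simp [h])
      (fun a b c d => abs_ite_ite_le (div_nonneg hC3h0 (mul_pos (hρ0 x a) (hρ0 x c)).le)) hnR hnR))
  have h18 := ((sum4_ytzs _).trans_le (two_point5_third_first_sum_le hK40 hK30 hαr hαc hk4r hk3c hD hDr hDc hl1 x))
  have h19 := ((sum4_zsyt _).trans_le (two_point5_third_first_sum_le hK40 hK30 hαr hαc hk4r hk3c hD hDr hDc hl1 x))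
  have h20 := ((sum4_ytzs _).trans_le ((sum4_le_abs _).trans (two_supports_triangle_sum_le_two (fun a b c d : ι => if Hk b a = 0 then (0:ℝ) else if
      Hk d c = 0 then (0:ℝ) else C3h / (ρ x a * ρ x c)) (fun a b => Hk b a) (fun c d => Hk d c) x hC3h0 hρ1 hS (fun a b h c d => if_pos h) (fun c d h
      a b => by simp [h]) (fun a b c d => abs_ite_ite_le (div_nonneg hC3h0 (mul_pos (hρ0 x a) (hρ0 x c)).le)) hnR hnR)))
  have h21 := ((sum4_yszt _).trans_le (two_point5_third_first_sum_le hK40 hK30 hαr hαc hk4r hk3c hD hDr hDc hl1 x))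
  have h22 := ((sum4_ztys _).trans_le (two_point5_third_first_sum_le hK40 hK30 hαr hαc hk4r hk3c hD hDr hDc hl1 x))
  have h23 := ((sum4_yszt _).trans_le ((sum4_le_abs _).trans (two_supports_triangle_sum_le_two (fun a b c d : ι => if Hk b a = 0 then (0:ℝ) else if
      Hk d c = 0 then (0:ℝ) else C3h / (ρ x a * ρ x c)) (fun a b => Hk b a) (fun c d => Hk d c) x hC3h0 hρ1 hS (fun a b h c d => if_pos h) (fun c d h
      a b => by simp [h]) (fun a b c d => abs_ite_ite_le (div_nonneg hC3h0 (mul_pos (hρ0 x a) (hρ0 x c)).le)) hnR hnR)))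
  have h24 := ((sum4_le_abs _).trans (pair_support_triangle_sum_le (fun a b c d : ι => if K3 a b x = 0 then (0:ℝ) else C3k / (ρ x c * ρ x d)) (fun a
      b => K3 a b x) x hC3k0 hρ1 hS (fun a b h c d => if_pos h) (fun a b c d => abs_ite_le (div_nonneg hC3k0 (mul_pos (hρ0 x c) (hρ0 x d)).le)) (hn3
      x)))
  have h25 := ((sum4_tyzs _).trans_le ((sum4_le_abs _).trans (two_supports_triangle_sum_le (fun a b c d : ι => if Hk a x = 0 then (0:ℝ) else if Hk c
      b = 0 then (0:ℝ) else C3h / (ρ x b * ρ x d)) (fun a => Hk a x) (fun b c => Hk c b) x hC3h0 hρ1 hS (fun a h b c d => if_pos h) (fun b c h a d =>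
      by simp [h]) (fun a b c d => abs_ite_ite_le (div_nonneg hC3h0 (mul_pos (hρ0 x b) (hρ0 x d)).le)) (hnR x) hnR)))
  have h26 := ((sum4_syzt _).trans_le ((sum4_le_abs _).trans (two_supports_triangle_sum_le (fun a b c d : ι => if Hk a x = 0 then (0:ℝ) else if Hk c
      b = 0 then (0:ℝ) else C3h / (ρ x b * ρ x d)) (fun a => Hk a x) (fun b c => Hk c b) x hC3h0 hρ1 hS (fun a h b c d => if_pos h) (fun b c h a d =>
      by simp [h]) (fun a b c d => abs_ite_ite_le (div_nonneg hC3h0 (mul_pos (hρ0 x b) (hρ0 x d)).le)) (hnR x) hnR)))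
  have h27 := ((sum4_le_abs _).trans (support_tree16_sum_le_two (q := fun u v => (r u v ^ 2)⁻¹) (fun a b c d : ι => (if Hk b a = 0 then (0:ℝ) else C4
      * (((r x a ^ 2)⁻¹ * (r x c ^ 2)⁻¹ * (r x d ^ 2)⁻¹ + (r x a ^ 2)⁻¹ * (r a c ^ 2)⁻¹ * (r a d ^ 2)⁻¹ + (r x c ^ 2)⁻¹ * (r a c ^ 2)⁻¹ * (r c d ^
      2)⁻¹ + (r x d ^ 2)⁻¹ * (r a d ^ 2)⁻¹ * (r c d ^ 2)⁻¹ + (r x a ^ 2)⁻¹ * (r a c ^ 2)⁻¹ * (r c d ^ 2)⁻¹ + (r x a ^ 2)⁻¹ * (r a d ^ 2)⁻¹ * (r c d ^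
      2)⁻¹ + (r x c ^ 2)⁻¹ * (r a c ^ 2)⁻¹ * (r a d ^ 2)⁻¹ + (r x c ^ 2)⁻¹ * (r a d ^ 2)⁻¹ * (r c d ^ 2)⁻¹ + (r x d ^ 2)⁻¹ * (r a c ^ 2)⁻¹ * (r a d ^
      2)⁻¹ + (r x d ^ 2)⁻¹ * (r a c ^ 2)⁻¹ * (r c d ^ 2)⁻¹ + (r x a ^ 2)⁻¹ * (r x c ^ 2)⁻¹ * (r c d ^ 2)⁻¹ + (r x a ^ 2)⁻¹ * (r x d ^ 2)⁻¹ * (r c d ^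
      2)⁻¹ + (r x a ^ 2)⁻¹ * (r x c ^ 2)⁻¹ * (r a d ^ 2)⁻¹ + (r x c ^ 2)⁻¹ * (r x d ^ 2)⁻¹ * (r a d ^ 2)⁻¹ + (r x a ^ 2)⁻¹ * (r x d ^ 2)⁻¹ * (r a c ^
      2)⁻¹ + (r x c ^ 2)⁻¹ * (r x d ^ 2)⁻¹ * (r a c ^ 2)⁻¹)))) (fun a b => Hk b a) x hC40 (fun u v => by positivity) hSr hSc (fun a b h c d => if_pos
      h) (fun a b c d => abs_ite_le (mul_nonneg hC40 (by positivity))) hnR))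
  have h28 := ((sum4_ytzs _).trans_le ((sum4_le_abs _).trans (pair_support_triangle_sum_le (fun a b c d : ι => if K3 a b x = 0 then (0:ℝ) else C3k /
      (ρ x c * ρ x d)) (fun a b => K3 a b x) x hC3k0 hρ1 hS (fun a b h c d => if_pos h) (fun a b c d => abs_ite_le (div_nonneg hC3k0 (mul_pos (hρ0 x
      c) (hρ0 x d)).le)) (hn3 x))))
  have h29 := ((sum4_zyts _).trans_le ((sum4_le_abs _).trans (two_supports_triangle_sum_le (fun a b c d : ι => if Hk a x = 0 then (0:ℝ) else if Hk c
      b = 0 then (0:ℝ) else C3h / (ρ x b * ρ x d)) (fun a => Hk a x) (fun b c => Hk c b) x hC3h0 hρ1 hS (fun a h b c d => if_pos h) (fun b c h a d =>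
      by simp [h]) (fun a b c d => abs_ite_ite_le (div_nonneg hC3h0 (mul_pos (hρ0 x b) (hρ0 x d)).le)) (hnR x) hnR)))
  have h30 := ((sum4_sytz _).trans_le ((sum4_le_abs _).trans (two_supports_triangle_sum_le (fun a b c d : ι => if Hk a x = 0 then (0:ℝ) else if Hk c
      b = 0 then (0:ℝ) else C3h / (ρ x b * ρ x d)) (fun a => Hk a x) (fun b c => Hk c b) x hC3h0 hρ1 hS (fun a h b c d => if_pos h) (fun b c h a d =>
      by simp [h]) (fun a b c d => abs_ite_ite_le (div_nonneg hC3h0 (mul_pos (hρ0 x b) (hρ0 x d)).le)) (hnR x) hnR)))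
  have h31 := ((sum4_ytzs _).trans_le ((sum4_le_abs _).trans (support_tree16_sum_le_two (q := fun u v => (r u v ^ 2)⁻¹) (fun a b c d : ι => (if Hk b
      a = 0 then (0:ℝ) else C4 * (((r x a ^ 2)⁻¹ * (r x c ^ 2)⁻¹ * (r x d ^ 2)⁻¹ + (r x a ^ 2)⁻¹ * (r a c ^ 2)⁻¹ * (r a d ^ 2)⁻¹ + (r x c ^ 2)⁻¹ * (r
      a c ^ 2)⁻¹ * (r c d ^ 2)⁻¹ + (r x d ^ 2)⁻¹ * (r a d ^ 2)⁻¹ * (r c d ^ 2)⁻¹ + (r x a ^ 2)⁻¹ * (r a c ^ 2)⁻¹ * (r c d ^ 2)⁻¹ + (r x a ^ 2)⁻¹ * (r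
      a d ^ 2)⁻¹ * (r c d ^ 2)⁻¹ + (r x c ^ 2)⁻¹ * (r a c ^ 2)⁻¹ * (r a d ^ 2)⁻¹ + (r x c ^ 2)⁻¹ * (r a d ^ 2)⁻¹ * (r c d ^ 2)⁻¹ + (r x d ^ 2)⁻¹ * (r
      a c ^ 2)⁻¹ * (r a d ^ 2)⁻¹ + (r x d ^ 2)⁻¹ * (r a c ^ 2)⁻¹ * (r c d ^ 2)⁻¹ + (r x a ^ 2)⁻¹ * (r x c ^ 2)⁻¹ * (r c d ^ 2)⁻¹ + (r x a ^ 2)⁻¹ * (r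
      x d ^ 2)⁻¹ * (r c d ^ 2)⁻¹ + (r x a ^ 2)⁻¹ * (r x c ^ 2)⁻¹ * (r a d ^ 2)⁻¹ + (r x c ^ 2)⁻¹ * (r x d ^ 2)⁻¹ * (r a d ^ 2)⁻¹ + (r x a ^ 2)⁻¹ * (r
      x d ^ 2)⁻¹ * (r a c ^ 2)⁻¹ + (r x c ^ 2)⁻¹ * (r x d ^ 2)⁻¹ * (r a c ^ 2)⁻¹)))) (fun a b => Hk b a) x hC40 (fun u v => by positivity) hSr hSc
      (fun a b h c d => if_pos h) (fun a b c d => abs_ite_le (mul_nonneg hC40 (by positivity))) hnR)))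
  have h32 := ((sum4_yszt _).trans_le ((sum4_le_abs _).trans (pair_support_triangle_sum_le (fun a b c d : ι => if K3 a b x = 0 then (0:ℝ) else C3k /
      (ρ x c * ρ x d)) (fun a b => K3 a b x) x hC3k0 hρ1 hS (fun a b h c d => if_pos h) (fun a b c d => abs_ite_le (div_nonneg hC3k0 (mul_pos (hρ0 x
      c) (hρ0 x d)).le)) (hn3 x))))
  have h33 := ((sum4_zyst _).trans_le ((sum4_le_abs _).trans (two_supports_triangle_sum_le (fun a b c d : ι => if Hk a x = 0 then (0:ℝ) else if Hk c
      b = 0 then (0:ℝ) else C3h / (ρ x b * ρ x d)) (fun a => Hk a x) (fun b c => Hk c b) x hC3h0 hρ1 hS (fun a h b c d => if_pos h) (fun b c h a d =>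
      by simp [h]) (fun a b c d => abs_ite_ite_le (div_nonneg hC3h0 (mul_pos (hρ0 x b) (hρ0 x d)).le)) (hnR x) hnR)))
  have h34 := ((sum4_tysz _).trans_le ((sum4_le_abs _).trans (two_supports_triangle_sum_le (fun a b c d : ι => if Hk a x = 0 then (0:ℝ) else if Hk c
      b = 0 then (0:ℝ) else C3h / (ρ x b * ρ x d)) (fun a => Hk a x) (fun b c => Hk c b) x hC3h0 hρ1 hS (fun a h b c d => if_pos h) (fun b c h a d =>
      by simp [h]) (fun a b c d => abs_ite_ite_le (div_nonneg hC3h0 (mul_pos (hρ0 x b) (hρ0 x d)).le)) (hnR x) hnR)))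
  have h35 := ((sum4_yszt _).trans_le ((sum4_le_abs _).trans (support_tree16_sum_le_two (q := fun u v => (r u v ^ 2)⁻¹) (fun a b c d : ι => (if Hk b
      a = 0 then (0:ℝ) else C4 * (((r x a ^ 2)⁻¹ * (r x c ^ 2)⁻¹ * (r x d ^ 2)⁻¹ + (r x a ^ 2)⁻¹ * (r a c ^ 2)⁻¹ * (r a d ^ 2)⁻¹ + (r x c ^ 2)⁻¹ * (r
      a c ^ 2)⁻¹ * (r c d ^ 2)⁻¹ + (r x d ^ 2)⁻¹ * (r a d ^ 2)⁻¹ * (r c d ^ 2)⁻¹ + (r x a ^ 2)⁻¹ * (r a c ^ 2)⁻¹ * (r c d ^ 2)⁻¹ + (r x a ^ 2)⁻¹ * (r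
      a d ^ 2)⁻¹ * (r c d ^ 2)⁻¹ + (r x c ^ 2)⁻¹ * (r a c ^ 2)⁻¹ * (r a d ^ 2)⁻¹ + (r x c ^ 2)⁻¹ * (r a d ^ 2)⁻¹ * (r c d ^ 2)⁻¹ + (r x d ^ 2)⁻¹ * (r
      a c ^ 2)⁻¹ * (r a d ^ 2)⁻¹ + (r x d ^ 2)⁻¹ * (r a c ^ 2)⁻¹ * (r c d ^ 2)⁻¹ + (r x a ^ 2)⁻¹ * (r x c ^ 2)⁻¹ * (r c d ^ 2)⁻¹ + (r x a ^ 2)⁻¹ * (r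
      x d ^ 2)⁻¹ * (r c d ^ 2)⁻¹ + (r x a ^ 2)⁻¹ * (r x c ^ 2)⁻¹ * (r a d ^ 2)⁻¹ + (r x c ^ 2)⁻¹ * (r x d ^ 2)⁻¹ * (r a d ^ 2)⁻¹ + (r x a ^ 2)⁻¹ * (r
      x d ^ 2)⁻¹ * (r a c ^ 2)⁻¹ + (r x c ^ 2)⁻¹ * (r x d ^ 2)⁻¹ * (r a c ^ 2)⁻¹)))) (fun a b => Hk b a) x hC40 (fun u v => by positivity) hSr hSc
      (fun a b h c d => if_pos h) (fun a b c d => abs_ite_le (mul_nonneg hC40 (by positivity))) hnR)))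
  have h36 := ((sum4_le_abs _).trans (two_supports_triangle_sum_le (fun a b c d : ι => if Hk a x = 0 then (0:ℝ) else if Hk c b = 0 then (0:ℝ) else
      C3h / (ρ x b * ρ x d)) (fun a => Hk a x) (fun b c => Hk c b) x hC3h0 hρ1 hS (fun a h b c d => if_pos h) (fun b c h a d => by simp [h]) (fun a b
      c d => abs_ite_ite_le (div_nonneg hC3h0 (mul_pos (hρ0 x b) (hρ0 x d)).le)) (hnR x) hnR))
  have h37 := ((sum4_ztys _).trans_le ((sum4_le_abs _).trans (pair_support_triangle_sum_le (fun a b c d : ι => if K3 a b x = 0 then (0:ℝ) else C3k /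
      (ρ x c * ρ x d)) (fun a b => K3 a b x) x hC3k0 hρ1 hS (fun a b h c d => if_pos h) (fun a b c d => abs_ite_le (div_nonneg hC3k0 (mul_pos (hρ0 x
      c) (hρ0 x d)).le)) (hn3 x))))
  have h38 := ((sum4_szty _).trans_le ((sum4_le_abs _).trans (two_supports_triangle_sum_le (fun a b c d : ι => if Hk a x = 0 then (0:ℝ) else if Hk c
      b = 0 then (0:ℝ) else C3h / (ρ x b * ρ x d)) (fun a => Hk a x) (fun b c => Hk c b) x hC3h0 hρ1 hS (fun a h b c d => if_pos h) (fun b c h a d =>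
      by simp [h]) (fun a b c d => abs_ite_ite_le (div_nonneg hC3h0 (mul_pos (hρ0 x b) (hρ0 x d)).le)) (hnR x) hnR)))
  have h39 := ((sum4_ztys _).trans_le ((sum4_le_abs _).trans (support_tree16_sum_le_two (q := fun u v => (r u v ^ 2)⁻¹) (fun a b c d : ι => (if Hk b
      a = 0 then (0:ℝ) else C4 * (((r x a ^ 2)⁻¹ * (r x c ^ 2)⁻¹ * (r x d ^ 2)⁻¹ + (r x a ^ 2)⁻¹ * (r a c ^ 2)⁻¹ * (r a d ^ 2)⁻¹ + (r x c ^ 2)⁻¹ * (r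
      a c ^ 2)⁻¹ * (r c d ^ 2)⁻¹ + (r x d ^ 2)⁻¹ * (r a d ^ 2)⁻¹ * (r c d ^ 2)⁻¹ + (r x a ^ 2)⁻¹ * (r a c ^ 2)⁻¹ * (r c d ^ 2)⁻¹ + (r x a ^ 2)⁻¹ * (r
      a d ^ 2)⁻¹ * (r c d ^ 2)⁻¹ + (r x c ^ 2)⁻¹ * (r a c ^ 2)⁻¹ * (r a d ^ 2)⁻¹ + (r x c ^ 2)⁻¹ * (r a d ^ 2)⁻¹ * (r c d ^ 2)⁻¹ + (r x d ^ 2)⁻¹ * (r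
      a c ^ 2)⁻¹ * (r a d ^ 2)⁻¹ + (r x d ^ 2)⁻¹ * (r a c ^ 2)⁻¹ * (r c d ^ 2)⁻¹ + (r x a ^ 2)⁻¹ * (r x c ^ 2)⁻¹ * (r c d ^ 2)⁻¹ + (r x a ^ 2)⁻¹ * (r
      x d ^ 2)⁻¹ * (r c d ^ 2)⁻¹ + (r x a ^ 2)⁻¹ * (r x c ^ 2)⁻¹ * (r a d ^ 2)⁻¹ + (r x c ^ 2)⁻¹ * (r x d ^ 2)⁻¹ * (r a d ^ 2)⁻¹ + (r x a ^ 2)⁻¹ * (r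
      x d ^ 2)⁻¹ * (r a c ^ 2)⁻¹ + (r x c ^ 2)⁻¹ * (r x d ^ 2)⁻¹ * (r a c ^ 2)⁻¹)))) (fun a b => Hk b a) x hC40 (fun u v => by positivity) hSr hSc
      (fun a b h c d => if_pos h) (fun a b c d => abs_ite_le (mul_nonneg hC40 (by positivity))) hnR)))
  have h40 := ((sum4_yzst _).trans_le ((sum4_le_abs _).trans (two_supports_triangle_sum_le (fun a b c d : ι => if Hk a x = 0 then (0:ℝ) else if Hk c
      b = 0 then (0:ℝ) else C3h / (ρ x b * ρ x d)) (fun a => Hk a x) (fun b c => Hk c b) x hC3h0 hρ1 hS (fun a h b c d => if_pos h) (fun b c h a d =>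
      by simp [h]) (fun a b c d => abs_ite_ite_le (div_nonneg hC3h0 (mul_pos (hρ0 x b) (hρ0 x d)).le)) (hnR x) hnR)))
  have h41 := ((sum4_zsyt _).trans_le ((sum4_le_abs _).trans (pair_support_triangle_sum_le (fun a b c d : ι => if K3 a b x = 0 then (0:ℝ) else C3k /
      (ρ x c * ρ x d)) (fun a b => K3 a b x) x hC3k0 hρ1 hS (fun a b h c d => if_pos h) (fun a b c d => abs_ite_le (div_nonneg hC3k0 (mul_pos (hρ0 x
      c) (hρ0 x d)).le)) (hn3 x))))
  have h42 := ((sum4_tzsy _).trans_le ((sum4_le_abs _).trans (two_supports_triangle_sum_le (fun a b c d : ι => if Hk a x = 0 then (0:ℝ) else if Hk c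
      b = 0 then (0:ℝ) else C3h / (ρ x b * ρ x d)) (fun a => Hk a x) (fun b c => Hk c b) x hC3h0 hρ1 hS (fun a h b c d => if_pos h) (fun b c h a d =>
      by simp [h]) (fun a b c d => abs_ite_ite_le (div_nonneg hC3h0 (mul_pos (hρ0 x b) (hρ0 x d)).le)) (hnR x) hnR)))
  have h43 := ((sum4_zsyt _).trans_le ((sum4_le_abs _).trans (support_tree16_sum_le_two (q := fun u v => (r u v ^ 2)⁻¹) (fun a b c d : ι => (if Hk b
      a = 0 then (0:ℝ) else C4 * (((r x a ^ 2)⁻¹ * (r x c ^ 2)⁻¹ * (r x d ^ 2)⁻¹ + (r x a ^ 2)⁻¹ * (r a c ^ 2)⁻¹ * (r a d ^ 2)⁻¹ + (r x c ^ 2)⁻¹ * (r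
      a c ^ 2)⁻¹ * (r c d ^ 2)⁻¹ + (r x d ^ 2)⁻¹ * (r a d ^ 2)⁻¹ * (r c d ^ 2)⁻¹ + (r x a ^ 2)⁻¹ * (r a c ^ 2)⁻¹ * (r c d ^ 2)⁻¹ + (r x a ^ 2)⁻¹ * (r
      a d ^ 2)⁻¹ * (r c d ^ 2)⁻¹ + (r x c ^ 2)⁻¹ * (r a c ^ 2)⁻¹ * (r a d ^ 2)⁻¹ + (r x c ^ 2)⁻¹ * (r a d ^ 2)⁻¹ * (r c d ^ 2)⁻¹ + (r x d ^ 2)⁻¹ * (r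
      a c ^ 2)⁻¹ * (r a d ^ 2)⁻¹ + (r x d ^ 2)⁻¹ * (r a c ^ 2)⁻¹ * (r c d ^ 2)⁻¹ + (r x a ^ 2)⁻¹ * (r x c ^ 2)⁻¹ * (r c d ^ 2)⁻¹ + (r x a ^ 2)⁻¹ * (r
      x d ^ 2)⁻¹ * (r c d ^ 2)⁻¹ + (r x a ^ 2)⁻¹ * (r x c ^ 2)⁻¹ * (r a d ^ 2)⁻¹ + (r x c ^ 2)⁻¹ * (r x d ^ 2)⁻¹ * (r a d ^ 2)⁻¹ + (r x a ^ 2)⁻¹ * (r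
      x d ^ 2)⁻¹ * (r a c ^ 2)⁻¹ + (r x c ^ 2)⁻¹ * (r x d ^ 2)⁻¹ * (r a c ^ 2)⁻¹)))) (fun a b => Hk b a) x hC40 (fun u v => by positivity) hSr hSc
      (fun a b h c d => if_pos h) (fun a b c d => abs_ite_le (mul_nonneg hC40 (by positivity))) hnR)))
  have h44 := ((sum4_ytsz _).trans_le ((sum4_le_abs _).trans (two_supports_triangle_sum_le (fun a b c d : ι => if Hk a x = 0 then (0:ℝ) else if Hk c
      b = 0 then (0:ℝ) else C3h / (ρ x b * ρ x d)) (fun a => Hk a x) (fun b c => Hk c b) x hC3h0 hρ1 hS (fun a h b c d => if_pos h) (fun b c h a d =>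
      by simp [h]) (fun a b c d => abs_ite_ite_le (div_nonneg hC3h0 (mul_pos (hρ0 x b) (hρ0 x d)).le)) (hnR x) hnR)))
  have h45 := ((sum4_tsyz _).trans_le ((sum4_le_abs _).trans (pair_support_triangle_sum_le (fun a b c d : ι => if K3 a b x = 0 then (0:ℝ) else C3k /
      (ρ x c * ρ x d)) (fun a b => K3 a b x) x hC3k0 hρ1 hS (fun a b h c d => if_pos h) (fun a b c d => abs_ite_le (div_nonneg hC3k0 (mul_pos (hρ0 x
      c) (hρ0 x d)).le)) (hn3 x))))
  have h46 := ((sum4_ztsy _).trans_le ((sum4_le_abs _).trans (two_supports_triangle_sum_le (fun a b c d : ι => if Hk a x = 0 then (0:ℝ) else if Hk c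
      b = 0 then (0:ℝ) else C3h / (ρ x b * ρ x d)) (fun a => Hk a x) (fun b c => Hk c b) x hC3h0 hρ1 hS (fun a h b c d => if_pos h) (fun b c h a d =>
      by simp [h]) (fun a b c d => abs_ite_ite_le (div_nonneg hC3h0 (mul_pos (hρ0 x b) (hρ0 x d)).le)) (hnR x) hnR)))
  have h47 := ((sum4_tsyz _).trans_le ((sum4_le_abs _).trans (support_tree16_sum_le_two (q := fun u v => (r u v ^ 2)⁻¹) (fun a b c d : ι => (if Hk b
      a = 0 then (0:ℝ) else C4 * (((r x a ^ 2)⁻¹ * (r x c ^ 2)⁻¹ * (r x d ^ 2)⁻¹ + (r x a ^ 2)⁻¹ * (r a c ^ 2)⁻¹ * (r a d ^ 2)⁻¹ + (r x c ^ 2)⁻¹ * (r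
      a c ^ 2)⁻¹ * (r c d ^ 2)⁻¹ + (r x d ^ 2)⁻¹ * (r a d ^ 2)⁻¹ * (r c d ^ 2)⁻¹ + (r x a ^ 2)⁻¹ * (r a c ^ 2)⁻¹ * (r c d ^ 2)⁻¹ + (r x a ^ 2)⁻¹ * (r
      a d ^ 2)⁻¹ * (r c d ^ 2)⁻¹ + (r x c ^ 2)⁻¹ * (r a c ^ 2)⁻¹ * (r a d ^ 2)⁻¹ + (r x c ^ 2)⁻¹ * (r a d ^ 2)⁻¹ * (r c d ^ 2)⁻¹ + (r x d ^ 2)⁻¹ * (r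
      a c ^ 2)⁻¹ * (r a d ^ 2)⁻¹ + (r x d ^ 2)⁻¹ * (r a c ^ 2)⁻¹ * (r c d ^ 2)⁻¹ + (r x a ^ 2)⁻¹ * (r x c ^ 2)⁻¹ * (r c d ^ 2)⁻¹ + (r x a ^ 2)⁻¹ * (r
      x d ^ 2)⁻¹ * (r c d ^ 2)⁻¹ + (r x a ^ 2)⁻¹ * (r x c ^ 2)⁻¹ * (r a d ^ 2)⁻¹ + (r x c ^ 2)⁻¹ * (r x d ^ 2)⁻¹ * (r a d ^ 2)⁻¹ + (r x a ^ 2)⁻¹ * (r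
      x d ^ 2)⁻¹ * (r a c ^ 2)⁻¹ + (r x c ^ 2)⁻¹ * (r x d ^ 2)⁻¹ * (r a c ^ 2)⁻¹)))) (fun a b => Hk b a) x hC40 (fun u v => by positivity) hSr hSc
      (fun a b h c d => if_pos h) (fun a b c d => abs_ite_le (mul_nonneg hC40 (by positivity))) hnR)))
  have h48 := ((sum4_le_abs _).trans (support_tree16_sum_le (q := fun u v => (r u v ^ 2)⁻¹) (fun a b c d : ι => (if Hk a x = 0 then (0:ℝ) else C4 *
      (((r x b ^ 2)⁻¹ * (r x c ^ 2)⁻¹ * (r x d ^ 2)⁻¹ + (r x b ^ 2)⁻¹ * (r b c ^ 2)⁻¹ * (r b d ^ 2)⁻¹ + (r x c ^ 2)⁻¹ * (r b c ^ 2)⁻¹ * (r c d ^ 2)⁻¹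
      + (r x d ^ 2)⁻¹ * (r b d ^ 2)⁻¹ * (r c d ^ 2)⁻¹ + (r x b ^ 2)⁻¹ * (r b c ^ 2)⁻¹ * (r c d ^ 2)⁻¹ + (r x b ^ 2)⁻¹ * (r b d ^ 2)⁻¹ * (r c d ^ 2)⁻¹
      + (r x c ^ 2)⁻¹ * (r b c ^ 2)⁻¹ * (r b d ^ 2)⁻¹ + (r x c ^ 2)⁻¹ * (r b d ^ 2)⁻¹ * (r c d ^ 2)⁻¹ + (r x d ^ 2)⁻¹ * (r b c ^ 2)⁻¹ * (r b d ^ 2)⁻¹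
      + (r x d ^ 2)⁻¹ * (r b c ^ 2)⁻¹ * (r c d ^ 2)⁻¹ + (r x b ^ 2)⁻¹ * (r x c ^ 2)⁻¹ * (r c d ^ 2)⁻¹ + (r x b ^ 2)⁻¹ * (r x d ^ 2)⁻¹ * (r c d ^ 2)⁻¹
      + (r x b ^ 2)⁻¹ * (r x c ^ 2)⁻¹ * (r b d ^ 2)⁻¹ + (r x c ^ 2)⁻¹ * (r x d ^ 2)⁻¹ * (r b d ^ 2)⁻¹ + (r x b ^ 2)⁻¹ * (r x d ^ 2)⁻¹ * (r b c ^ 2)⁻¹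
      + (r x c ^ 2)⁻¹ * (r x d ^ 2)⁻¹ * (r b c ^ 2)⁻¹)))) (fun a => Hk a x) x hC40 (fun u v => by positivity) hSr hSc (fun a h b c d => if_pos h)
      (fun a b c d => abs_ite_le (mul_nonneg hC40 (by positivity))) (hnR x)))
  have h49 := ((sum4_zyts _).trans_le ((sum4_le_abs _).trans (support_tree16_sum_le (q := fun u v => (r u v ^ 2)⁻¹) (fun a b c d : ι => (if Hk a x =
      0 then (0:ℝ) else C4 * (((r x b ^ 2)⁻¹ * (r x c ^ 2)⁻¹ * (r x d ^ 2)⁻¹ + (r x b ^ 2)⁻¹ * (r b c ^ 2)⁻¹ * (r b d ^ 2)⁻¹ + (r x c ^ 2)⁻¹ * (r b c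
      ^ 2)⁻¹ * (r c d ^ 2)⁻¹ + (r x d ^ 2)⁻¹ * (r b d ^ 2)⁻¹ * (r c d ^ 2)⁻¹ + (r x b ^ 2)⁻¹ * (r b c ^ 2)⁻¹ * (r c d ^ 2)⁻¹ + (r x b ^ 2)⁻¹ * (r b d
      ^ 2)⁻¹ * (r c d ^ 2)⁻¹ + (r x c ^ 2)⁻¹ * (r b c ^ 2)⁻¹ * (r b d ^ 2)⁻¹ + (r x c ^ 2)⁻¹ * (r b d ^ 2)⁻¹ * (r c d ^ 2)⁻¹ + (r x d ^ 2)⁻¹ * (r b c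
      ^ 2)⁻¹ * (r b d ^ 2)⁻¹ + (r x d ^ 2)⁻¹ * (r b c ^ 2)⁻¹ * (r c d ^ 2)⁻¹ + (r x b ^ 2)⁻¹ * (r x c ^ 2)⁻¹ * (r c d ^ 2)⁻¹ + (r x b ^ 2)⁻¹ * (r x d
      ^ 2)⁻¹ * (r c d ^ 2)⁻¹ + (r x b ^ 2)⁻¹ * (r x c ^ 2)⁻¹ * (r b d ^ 2)⁻¹ + (r x c ^ 2)⁻¹ * (r x d ^ 2)⁻¹ * (r b d ^ 2)⁻¹ + (r x b ^ 2)⁻¹ * (r x d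
      ^ 2)⁻¹ * (r b c ^ 2)⁻¹ + (r x c ^ 2)⁻¹ * (r x d ^ 2)⁻¹ * (r b c ^ 2)⁻¹)))) (fun a => Hk a x) x hC40 (fun u v => by positivity) hSr hSc (fun a h
      b c d => if_pos h) (fun a b c d => abs_ite_le (mul_nonneg hC40 (by positivity))) (hnR x))))
  have h50 := ((sum4_tyzs _).trans_le ((sum4_le_abs _).trans (support_tree16_sum_le (q := fun u v => (r u v ^ 2)⁻¹) (fun a b c d : ι => (if Hk a x =
      0 then (0:ℝ) else C4 * (((r x b ^ 2)⁻¹ * (r x c ^ 2)⁻¹ * (r x d ^ 2)⁻¹ + (r x b ^ 2)⁻¹ * (r b c ^ 2)⁻¹ * (r b d ^ 2)⁻¹ + (r x c ^ 2)⁻¹ * (r b c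
      ^ 2)⁻¹ * (r c d ^ 2)⁻¹ + (r x d ^ 2)⁻¹ * (r b d ^ 2)⁻¹ * (r c d ^ 2)⁻¹ + (r x b ^ 2)⁻¹ * (r b c ^ 2)⁻¹ * (r c d ^ 2)⁻¹ + (r x b ^ 2)⁻¹ * (r b d
      ^ 2)⁻¹ * (r c d ^ 2)⁻¹ + (r x c ^ 2)⁻¹ * (r b c ^ 2)⁻¹ * (r b d ^ 2)⁻¹ + (r x c ^ 2)⁻¹ * (r b d ^ 2)⁻¹ * (r c d ^ 2)⁻¹ + (r x d ^ 2)⁻¹ * (r b c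
      ^ 2)⁻¹ * (r b d ^ 2)⁻¹ + (r x d ^ 2)⁻¹ * (r b c ^ 2)⁻¹ * (r c d ^ 2)⁻¹ + (r x b ^ 2)⁻¹ * (r x c ^ 2)⁻¹ * (r c d ^ 2)⁻¹ + (r x b ^ 2)⁻¹ * (r x d
      ^ 2)⁻¹ * (r c d ^ 2)⁻¹ + (r x b ^ 2)⁻¹ * (r x c ^ 2)⁻¹ * (r b d ^ 2)⁻¹ + (r x c ^ 2)⁻¹ * (r x d ^ 2)⁻¹ * (r b d ^ 2)⁻¹ + (r x b ^ 2)⁻¹ * (r x d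
      ^ 2)⁻¹ * (r b c ^ 2)⁻¹ + (r x c ^ 2)⁻¹ * (r x d ^ 2)⁻¹ * (r b c ^ 2)⁻¹)))) (fun a => Hk a x) x hC40 (fun u v => by positivity) hSr hSc (fun a h
      b c d => if_pos h) (fun a b c d => abs_ite_le (mul_nonneg hC40 (by positivity))) (hnR x))))
  have h51 := ((sum4_syzt _).trans_le ((sum4_le_abs _).trans (support_tree16_sum_le (q := fun u v => (r u v ^ 2)⁻¹) (fun a b c d : ι => (if Hk a x =
      0 then (0:ℝ) else C4 * (((r x b ^ 2)⁻¹ * (r x c ^ 2)⁻¹ * (r x d ^ 2)⁻¹ + (r x b ^ 2)⁻¹ * (r b c ^ 2)⁻¹ * (r b d ^ 2)⁻¹ + (r x c ^ 2)⁻¹ * (r b c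
      ^ 2)⁻¹ * (r c d ^ 2)⁻¹ + (r x d ^ 2)⁻¹ * (r b d ^ 2)⁻¹ * (r c d ^ 2)⁻¹ + (r x b ^ 2)⁻¹ * (r b c ^ 2)⁻¹ * (r c d ^ 2)⁻¹ + (r x b ^ 2)⁻¹ * (r b d
      ^ 2)⁻¹ * (r c d ^ 2)⁻¹ + (r x c ^ 2)⁻¹ * (r b c ^ 2)⁻¹ * (r b d ^ 2)⁻¹ + (r x c ^ 2)⁻¹ * (r b d ^ 2)⁻¹ * (r c d ^ 2)⁻¹ + (r x d ^ 2)⁻¹ * (r b c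
      ^ 2)⁻¹ * (r b d ^ 2)⁻¹ + (r x d ^ 2)⁻¹ * (r b c ^ 2)⁻¹ * (r c d ^ 2)⁻¹ + (r x b ^ 2)⁻¹ * (r x c ^ 2)⁻¹ * (r c d ^ 2)⁻¹ + (r x b ^ 2)⁻¹ * (r x d
      ^ 2)⁻¹ * (r c d ^ 2)⁻¹ + (r x b ^ 2)⁻¹ * (r x c ^ 2)⁻¹ * (r b d ^ 2)⁻¹ + (r x c ^ 2)⁻¹ * (r x d ^ 2)⁻¹ * (r b d ^ 2)⁻¹ + (r x b ^ 2)⁻¹ * (r x d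
      ^ 2)⁻¹ * (r b c ^ 2)⁻¹ + (r x c ^ 2)⁻¹ * (r x d ^ 2)⁻¹ * (r b c ^ 2)⁻¹)))) (fun a => Hk a x) x hC40 (fun u v => by positivity) hSr hSc (fun a h
      b c d => if_pos h) (fun a b c d => abs_ite_le (mul_nonneg hC40 (by positivity))) (hnR x))))
  have h52 := (const_mul_sum4_le hC50 (threshold_pow4_slot_1 (w := fun u v => (r u v)⁻¹) (fun u v => inv_nonneg.2 (zero_le_one.trans (hr1 u v))) (fun
      u v => by rw [hrs u v]) hS10 hS1 x))
  repeat rw [sum4_add]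
  exact ((add_le_add (add_le_add (add_le_add (add_le_add (add_le_add (add_le_add h1 h2) (add_le_add (add_le_add (add_le_add (add_le_add (add_le_add
      (add_le_add (add_le_add (add_le_add (add_le_add (add_le_add (add_le_add h3 h4) h5) h6) h7) h8) h9) h10) h11) h12) h13) h14)) (add_le_add
      (add_le_add (add_le_add (add_le_add (add_le_add (add_le_add (add_le_add (add_le_add h15 h16) h17) h18) h19) h20) h21) h22) h23)) (add_le_add
      (add_le_add (add_le_add (add_le_add (add_le_add (add_le_add (add_le_add (add_le_add (add_le_add (add_le_add (add_le_add h24 h25) h26) h27) h28)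
      h29) h30) h31) h32) h33) h34) h35)) (add_le_add (add_le_add (add_le_add (add_le_add (add_le_add (add_le_add (add_le_add (add_le_add (add_le_add
      (add_le_add (add_le_add h36 h37) h38) h39) h40) h41) h42) h43) h44) h45) h46) h47)) (add_le_add (add_le_add (add_le_add (add_le_add h48 h49)
      h50) h51) h52))).trans (le_of_eq (by ring))

end TheEnd

/-- Toy (the count): `1 + 15 + 25 + 10 + 1 = 52` terms. -/
example : 1 + 15 + 25 + 10 + 1 = 52 := by norm_num

end Summit.QuantumFields.BalabanUV.T4Continuum.NE7b.SupFifthKernelEntryLetterSlotOne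

end
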